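import Mathlib.CategoryTheory.Pi.Basic
import Mathlib.Algebra.Group.Subgroup.Pointwise
import Literature.IUT.HodgeTheaters.ConventionsTemperoids
import Literature.AnabelianGeometry.AbsoluteAnabelian.FundamentalExtension
import HarnessLib

/-!
# [IUTchI] Example 5.1 (v), (vii) and Remarks 5.1.1–5.1.5: coric structures, Kummer theory, labels

Mochizuki, *Inter-universal Teichmüller theory I*, §5, Example 5.1 "Global Frobenioids", parts (v)
(pp. 127–130), (vii) (p. 130), and Remarks 5.1.1–5.1.5 (pp. 131–134) ([IUTchI] Ex 5.1 (v),(vii),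
Rmk 5.1.1–5.1.5 pp.127–134) [claim: Mochizuki2012, status: disputed].  STATEMENTS-FIRST; nothing of
the disputed content is asserted.

**(v).**  `π₁(†𝒟^⊛) ↷ †𝕄^⊛` := the pair `π₁(†𝒟^⊛) ↷ 𝒪̃^⊛×` of (iv), `†𝕄^⊛_sol`, `†𝕄^⊛_mod` its
invariants; an *∞κ-coric* (resp. *∞κ×-coric*) *structure* on `†ℱ^⊛` := a pair [pseudo-monoid with
continuous `π₁^rat(†𝒟^⊛)`-action] ISOMORPHIC to the model pair `π₁^rat(†𝒟^⊛) ↷ 𝕄^⊛_∞κ(†𝒟^⊚)` (resp.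
`𝕄^⊛_∞κ×`) of (i) — `CoricPair`, `CoricPair.Iso`, `IsCoricStructure`; the action then factors
(resp. does not factor) through `π₁^{κ-sol}` — `CoricPair.FactorsThrough`; `μ_Ẑ((−)) := Hom(ℚ/ℤ, −)`
= the tree's `EtaleTheta.cyclotome` up to canonical isomorphism (not re-declared); the Kummer comparison: a UNIQUE isomorphism of cyclotomes
`μ^Θ_Ẑ(π₁(†𝒟^⊚)) ⥲ μ_Ẑ(†𝕄^⊛_∞κ)` inducing `𝕄^⊛_∞κ(†𝒟^⊚) ⥲ †𝕄^⊛_∞κ`, the uniqueness resting on "the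
elementary observation that, relative to `ℚ ↪ Ẑ ⊗ ℚ`, `ℚ_{>0} ∩ Ẑ^× = {1}`" — already proved in the
tree (`Literature.IUT.LogThetaLattice.Rat.eq_one_of_forall_padicValRat_eq_zero`);
"`†ℱ^⊛` always admits an ∞κ-coric structure, unique up to a uniquely determined isomorphism" —
`ExistsUniqueCoricStructure` (existence + the model pair has no non-trivial automorphism);
`Prime(†ℱ^⊛_mod) ⥲ 𝕍_mod`.  **(vii).**  `𝕍_j := {v_j}_{v ∈ 𝕍}`, `𝕍_J := ∏_j 𝕍_j`, the diagonal
`𝕍_⟨J⟩ ⊆ 𝕍_J` with `𝕍_⟨J⟩ ⥲ 𝕍_j ⥲ 𝕍` — REAL (`VProd`, `VDiag`, …); `†ℱ^⊛_⟨J⟩`, `†ℱ^⊛_j` = copies of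
`†ℱ^⊛_mod` (a category with an identification `≌ †ℱ^⊛_mod`) labelled by bijections with `Prime(†ℱ^⊛_mod)` —
`LabelledCopy`; `†ℱ^⊛_J := ∏_j †ℱ^⊛_j` and the diagonal embedding `†ℱ^⊛_⟨J⟩ ↪ †ℱ^⊛_J` — REAL over Mathlib's
product categories (`labelledProd`, `diagEmb`, faithful).  **Remarks.**  5.1.1 (constant vs arbitrary "distributions" on `𝕍_J`: prose, see
`diagEmb`); 5.1.2 (only the `𝒟`-NF-bridge is used: see `GlobalFrobenioids.lean`); 5.1.3
(*Kummer-ready* `†ℱ^⊚, †ℱ^⊛, †𝕄^⊛, †𝕄^⊛_sol, †𝕄^⊛_∞κ, †𝕄^⊛_∞κ×, †𝕄^⊛_{κ-sol}` vs *Kummer-blind*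
`†ℱ^⊛_mod, †𝕄^⊛_mod, †𝕄^⊛_κ` — `KummerStatus`, `kummerStatus`; its bracketed reason "it is not
necessarily the case that elements of `F^×_mod` … admit `N`-th roots": for `F_mod = ℚ`, `N = 2` this
is the tree's `curve480a1.not_isSquare_two`); 5.1.4 (prose: Belyi maps as "arithmetic analytic
continuation"); 5.1.5 (κ-sol-conjugate synchronization, typed in `GlobalFrobenioids.lean`; and "the
outer action [of `G_F` on `Δ`] does not admit a solvable factorization", a consequence of [NodNon]
Thm C — predicate `NoSolvableFactorization` on the tree's `FundamentalExtension`).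
Realifications `†ℱ^⊛ℝ_j, †ℱ^⊛ℝ_⟨J⟩, †ℱ^⊛ℝ_J` ([FrdI] Prop 5.3) and the completions `𝒪^⊿_𝔭̂`, the
"MLF-Galois TM-pair of strictly Belyi type" ([AbsTopIII] Def 3.1 (ii)) are the L1 / L4-t2 seats'
objects (TODO-merge) and are not re-typed.  No printed statement is strengthened; no side taken.
-/

namespace Literature.IUT.HodgeTheaters

open CategoryTheory Pointwise Literature.AnabelianGeometry.AbsoluteAnabelian

universe u' v u

/-! ### `μ_Ẑ` and the elementary observation `ℚ_{>0} ∩ Ẑ^× = {1}` (Ex. 5.1 (v), p. 127)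

`μ_Ẑ((−)) := Hom(ℚ/ℤ, (−))` for a commutative monoid (p. 127; [AbsTopIII] Def 3.1 (v), Def 5.1 (v))
is, up to the canonical isomorphism `Hom(ℚ/ℤ, A) ≅ lim_n A[n]`, the tree's cyclotome
`Literature.AnabelianGeometry.EtaleTheta.cyclotome A` (one cyclotome in the tree; not re-declared
here).  "The elementary observation that, relative to the natural inclusion `ℚ ↪ Ẑ ⊗ ℚ`,
`ℚ_{>0} ∩ Ẑ^× = {1}`" (p. 127) — a positive rational number all of whose `p`-adic valuations vanish
equals `1` — is ALREADY PROVED in the tree as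
`Literature.IUT.LogThetaLattice.Rat.eq_one_of_forall_padicValRat_eq_zero` ([IUTchIII] Rmk 2.3.3 (vi)
cites the same observation); it is not restated here (gate dedup), only recorded. -/

/-! ### Coric structures (Ex. 5.1 (v), p. 127) -/

section Coric

variable (Γ : Type u) [Group Γ] [TopologicalSpace Γ]

/-- A pair "consisting of a pseudo-monoid equipped with a continuous action by `π₁^rat(†𝒟^⊛)`"
(p. 127): a carrier with a partial multiplication (the tree's §0 `PartialMul`) and an action of `Γ`
with open stabilisers [continuity for the discrete topology] by partial-multiplication-preserving
maps. ([IUTchI] Ex 5.1 (v) p.127) [claim: Mochizuki2012, status: disputed] -/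
structure CoricPair : Type (u + 1) where
  /-- the underlying set of the pseudo-monoid -/
  carrier : Type u
  /-- its partial multiplication -/
  pm : PartialMul carrier
  [action : MulAction Γ carrier]
  isOpen_stabilizer : ∀ x : carrier, IsOpen (MulAction.stabilizer Γ x : Set Γ)
  smul_dom : ∀ (g : Γ) (p : carrier × carrier), p ∈ pm.dom ↔ (g • p.1, g • p.2) ∈ pm.dom
  smul_op : ∀ (g : Γ) (p : pm.dom), g • pm.op p = pm.op ⟨(g • p.1.1, g • p.1.2), (smul_dom g p.1).mp p.2⟩

namespace CoricPair

variable {Γ}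

attribute [instance] CoricPair.action

/-- An isomorphism of pairs: a `Γ`-equivariant bijection respecting the partial multiplications
(p. 127, "isomorphic [i.e., as a pair consisting of a pseudo-monoid equipped with a continuous action
…]"). ([IUTchI] Ex 5.1 (v) p.127) [claim: Mochizuki2012, status: disputed] -/
structure Iso (P Q : CoricPair Γ) : Type u where
  /-- the bijection -/
  toEquiv : P.carrier ≃ Q.carrier
  smul : ∀ (g : Γ) (x : P.carrier), toEquiv (g • x) = g • toEquiv x
  dom : ∀ p : P.carrier × P.carrier, p ∈ P.pm.dom ↔ (toEquiv p.1, toEquiv p.2) ∈ Q.pm.dom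
  op : ∀ p : P.pm.dom, toEquiv (P.pm.op p) = Q.pm.op ⟨(toEquiv p.1.1, toEquiv p.1.2), (dom p.1).mp p.2⟩

/-- The identity isomorphism of a pair. ([IUTchI] Ex 5.1 (v) p.127) [claim: Mochizuki2012, status: disputed] -/
def Iso.refl (P : CoricPair Γ) : Iso P P where
  toEquiv := Equiv.refl _
  smul _ _ := rfl
  dom _ := Iff.rfl
  op _ := rfl

/-- The `Γ`-action of the pair *factors through* the quotient by a subgroup `N` [e.g. `π₁^{rat/κ-sol}`]:
`N` acts trivially (p. 127: the action of an ∞κ-coric structure "necessarily factors (respectively,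
does not factor) through the natural surjection `π₁^rat(†𝒟^⊛) ↠ π₁^{κ-sol}(†𝒟^⊛)`").
([IUTchI] Ex 5.1 (v) p.127) [claim: Mochizuki2012, status: disputed] -/
def FactorsThrough (P : CoricPair Γ) (N : Subgroup Γ) : Prop := ∀ n ∈ N, ∀ x : P.carrier, n • x = x

/-- Factoring through a quotient is invariant under isomorphism of pairs. ([IUTchI] Ex 5.1 (v) p.127)
[claim: Mochizuki2012, status: disputed] -/
theorem FactorsThrough.of_iso {P Q : CoricPair Γ} (e : Iso P Q) {N : Subgroup Γ}
    (h : Q.FactorsThrough N) : P.FactorsThrough N := by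
  intro n hn x
  apply e.toEquiv.injective
  rw [e.smul, h n hn]

end CoricPair

/-- An *∞κ-coric* (resp. *∞κ×-coric*) *structure* on `†ℱ^⊛` relative to the model pair
`model = (π₁^rat(†𝒟^⊛) ↷ 𝕄^⊛_∞κ(†𝒟^⊚))` (resp. `𝕄^⊛_∞κ×`): a pair isomorphic to the model (p. 127).
([IUTchI] Ex 5.1 (v) p.127) [claim: Mochizuki2012, status: disputed] -/
@[mk_iff] structure IsCoricStructure (model P : CoricPair Γ) : Prop where
  nonempty_iso : Nonempty (CoricPair.Iso P model)

/-- "`†ℱ^⊛` always admits an ∞κ-coric (respectively, ∞κ×-coric) structure, which is, moreover, unique up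
to a uniquely determined isomorphism" (p. 128): existence, and rigidity of the model pair (any two
structures are then related by exactly one isomorphism of pairs compatible with the structure
isomorphisms).  A predicate, not asserted. ([IUTchI] Ex 5.1 (v) p.128) [claim: Mochizuki2012, status: disputed] -/
@[mk_iff] structure ExistsUniqueCoricStructure (model : CoricPair Γ) : Prop where
  exists_structure : ∃ P : CoricPair Γ, IsCoricStructure Γ model P
  subsingleton_iso : Subsingleton (CoricPair.Iso model model)

/-- Existence is immediate (the model is a structure on itself); the content of the display is the
uniqueness clause. ([IUTchI] Ex 5.1 (v) p.128) [claim: Mochizuki2012, status: disputed] -/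
theorem exists_coricStructure (model : CoricPair Γ) : ∃ P : CoricPair Γ, IsCoricStructure Γ model P :=
  ⟨model, ⟨⟨CoricPair.Iso.refl model⟩⟩⟩

/-- INTERFACE DATA for the Kummer comparison of (v) (pp. 127–128): two cyclotomes [`μ^Θ_Ẑ(π₁(†𝒟^⊚))`
and `μ_Ẑ(†𝕄^⊛_∞κ) := Hom(ℚ/ℤ, †𝕄^⊛_∞κ)`, i.e. instances of the tree's
`Literature.AnabelianGeometry.EtaleTheta.cyclotome`; carried abstractly here], the two targets of Kummer classes [`lim_H H¹(H, ·)`] with the subsets cut out by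
`𝕄^⊛_∞κ(†𝒟^⊚)` and by `†𝕄^⊛_∞κ`, and the map induced on targets by an isomorphism of cyclotomes.
TODO-merge:abc-iut-L2-t3 (Kummer map, LLANA N13), abc-iut-L4-t1 ([AbsTopIII] Thm 1.9 (d)).
([IUTchI] Ex 5.1 (v) p.127) [claim: Mochizuki2012, status: disputed] -/
structure CyclotomeComparison : Type (u + 1) where
  /-- the two cyclotomes -/
  μ₁ : Type u
  μ₂ : Type u
  [grp₁ : CommGroup μ₁]
  [grp₂ : CommGroup μ₂]
  /-- the two cohomological targets and the images of the Kummer maps -/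
  H₁ : Type u
  H₂ : Type u
  im₁ : Set H₁
  im₂ : Set H₂
  /-- the map on targets induced by an isomorphism of cyclotomes -/
  induced : (μ₁ ≃* μ₂) → H₁ → H₂

attribute [instance] CyclotomeComparison.grp₁ CyclotomeComparison.grp₂

/-- "There exists a unique isomorphism of cyclotomes `μ^Θ_Ẑ(π₁(†𝒟^⊚)) ⥲ μ_Ẑ(†𝕄^⊛_∞κ)` such that the
resulting isomorphism between direct limits of cohomology modules induces an isomorphism
`𝕄^⊛_∞κ(†𝒟^⊚) ⥲ †𝕄^⊛_∞κ`" (p. 128; likewise for `∞κ×` and for `†𝕄^⊛`).  A predicate on the data, not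
asserted. ([IUTchI] Ex 5.1 (v) p.128) [claim: Mochizuki2012, status: disputed] -/
@[mk_iff] structure UniqueCyclotomeIso (C : CyclotomeComparison.{u}) : Prop where
  existsUnique : ∃! e : C.μ₁ ≃* C.μ₂, Set.BijOn (C.induced e) C.im₁ C.im₂

end Coric

/-! ### Labels: `𝕍_j`, `𝕍_J`, `𝕍_⟨J⟩` and the labelled copies of `†ℱ^⊛_mod` (Ex. 5.1 (vii), p. 130) -/

section Labels

variable (J : Type v) (V : Type u)

/-- `𝕍_j := {v_j}_{v ∈ 𝕍}`, a copy of `𝕍` labelled by `j ∈ J`, with its bijection to `𝕍` (p. 130).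
([IUTchI] Ex 5.1 (vii) p.130) [claim: Mochizuki2012, status: disputed] -/
abbrev VCopy (_j : J) : Type u := V

/-- The natural bijection `𝕍_j ⥲ 𝕍`, `v_j ↦ v` (p. 130). ([IUTchI] Ex 5.1 (vii) p.130)
[claim: Mochizuki2012, status: disputed] -/
abbrev VCopy.equiv (j : J) : VCopy J V j ≃ V := Equiv.refl _

/-- `𝕍_J := ∏_{j ∈ J} 𝕍_j` (p. 130). ([IUTchI] Ex 5.1 (vii) p.130) [claim: Mochizuki2012, status: disputed] -/
abbrev VProd : Type (max u v) := ∀ j : J, VCopy J V j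

/-- The "diagonal subset" `𝕍_⟨J⟩ ⊆ 𝕍_J` determined by the bijections `𝕍_j ⥲ 𝕍` (p. 130): tuples all of
whose coordinates name the same `v ∈ 𝕍` (Remark 5.1.1: "constant distributions").
([IUTchI] Ex 5.1 (vii) p.130) [claim: Mochizuki2012, status: disputed] -/
def VDiag : Set (VProd J V) := {x | ∃ v : V, ∀ j, VCopy.equiv J V j (x j) = v}

variable {J V}

/-- The natural bijection `𝕍_⟨J⟩ ⥲ 𝕍` (p. 130), for nonempty `J`. ([IUTchI] Ex 5.1 (vii) p.130)
[claim: Mochizuki2012, status: disputed] -/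
noncomputable def VDiag.equiv [Nonempty J] : VDiag J V ≃ V where
  toFun x := x.1 (Classical.arbitrary J)
  invFun v := ⟨fun _ => v, v, fun _ => rfl⟩
  left_inv x := by
    obtain ⟨x, v, hv⟩ := x
    apply Subtype.ext
    funext j
    have h1 : x j = v := hv j
    have h2 : x (Classical.arbitrary J) = v := hv (Classical.arbitrary J)
    change x (Classical.arbitrary J) = x j
    rw [h1, h2]
  right_inv v := rfl

variable (J)

/-- `†ℱ^⊛_j := {†ℱ^⊛_mod, 𝕍_j ⥲ Prime(†ℱ^⊛_mod)}`, `†ℱ^⊛_⟨J⟩ := {†ℱ^⊛_mod, 𝕍_⟨J⟩ ⥲ Prime(†ℱ^⊛_mod)}` (p. 130): "a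
copy of `†ℱ^⊛_mod` situated on" a constituent (resp. diagonally), i.e. a category `cat` TOGETHER WITH
its identification `cat ≌ †ℱ^⊛_mod` as a copy and the labelling bijection of the primes of `†ℱ^⊛_mod`
(`Prime(†ℱ^⊛_mod) ⥲ 𝕍_mod` from (v)) by the label set `L` (`= 𝕍_j`, resp. `𝕍_⟨J⟩`).
([IUTchI] Ex 5.1 (vii) p.130) [claim: Mochizuki2012, status: disputed] -/
structure LabelledCopy (Fmod : Type u) [Category.{v} Fmod] (Prime : Type u) (L : Type u') where
  /-- the underlying category of the copy -/
  cat : Type u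
  [inst : Category.{v} cat]
  /-- "a copy of `†ℱ^⊛_mod`" -/
  copyEquiv : cat ≌ Fmod
  /-- the labelling bijection `L ⥲ Prime(†ℱ^⊛_mod)` -/
  label : L ≃ Prime

attribute [instance] LabelledCopy.inst

variable {Fmod : Type u} [Category.{v} Fmod] {Prime : Type u}

/-- The tautological copy: `†ℱ^⊛_mod` itself, labelled by `e`. ([IUTchI] Ex 5.1 (vii) p.130)
[claim: Mochizuki2012, status: disputed] -/
def LabelledCopy.self {L : Type u'} (e : L ≃ Prime) : LabelledCopy Fmod Prime L where
  cat := Fmod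
  copyEquiv := CategoryTheory.Equivalence.refl
  label := e

/-- `†ℱ^⊛_J := ∏_{j ∈ J} †ℱ^⊛_j`, the product of the underlying categories of the labelled copies — "we do
not regard `†ℱ^⊛_J` as being equipped with a Frobenioid structure" (p. 130).
([IUTchI] Ex 5.1 (vii) p.130) [claim: Mochizuki2012, status: disputed] -/
abbrev labelledProd (F : ∀ j : J, LabelledCopy Fmod Prime (VCopy J V j)) : Type (max v u) :=
  ∀ j : J, (F j).cat

/-- The natural embedding of categories `†ℱ^⊛_⟨J⟩ ↪ †ℱ^⊛_J` (p. 130): through the identifications with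
`†ℱ^⊛_mod`, the diagonal functor (Remark 5.1.1: "constant distributions" inside "arbitrary
distributions"). ([IUTchI] Ex 5.1 (vii) p.130) [claim: Mochizuki2012, status: disputed] -/
def diagEmb (D : LabelledCopy Fmod Prime (VDiag J V))
    (F : ∀ j : J, LabelledCopy Fmod Prime (VCopy J V j)) : D.cat ⥤ labelledProd J F :=
  D.copyEquiv.functor ⋙ Functor.pi' fun j => (F j).copyEquiv.inverse

/-- The diagonal embedding is faithful (for nonempty `J`). ([IUTchI] Ex 5.1 (vii) p.130)
[claim: Mochizuki2012, status: disputed] -/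
theorem diagEmb_faithful [Nonempty J] (D : LabelledCopy Fmod Prime (VDiag J V))
    (F : ∀ j : J, LabelledCopy Fmod Prime (VCopy J V j)) : (diagEmb J D F).Faithful := by
  haveI : (Functor.pi' fun j => (F j).copyEquiv.inverse).Faithful :=
    ⟨fun {_ _} f g h => by
      have hj := congrFun h (Classical.arbitrary J)
      exact (F (Classical.arbitrary J)).copyEquiv.inverse.map_injective hj⟩
  exact Functor.Faithful.comp _ _

end Labels

/-! ### Remarks 5.1.3 and 5.1.5 (pp. 131–134) -/

/-- The two Kummer-theoretic statuses of Remark 5.1.3 (p. 132). ([IUTchI] Rmk 5.1.3 p.132)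
[claim: Mochizuki2012, status: disputed] -/
inductive KummerStatus
  | ready
  | blind
  deriving DecidableEq

/-- The ten objects classified in Remark 5.1.3 (pp. 131–132). ([IUTchI] Rmk 5.1.3 p.131)
[claim: Mochizuki2012, status: disputed] -/
inductive Ex51Object
  | Fcirc | Fast | Mast | Msol | Minfκ | Minfκx | Mκsol | Fmod | Mmod | Mκ
  deriving DecidableEq

/-- **Remark 5.1.3** (pp. 131–132): `†ℱ^⊚, †ℱ^⊛, †𝕄^⊛, †𝕄^⊛_sol, †𝕄^⊛_∞κ, †𝕄^⊛_∞κ×, †𝕄^⊛_{κ-sol}` are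
*Kummer-ready* [one can perform Kummer theory ([FrdII] Def 2.1 (ii)) with them], whereas `†ℱ^⊛_mod,
†𝕄^⊛_mod, †𝕄^⊛_κ` are *Kummer-blind* ("it is not necessarily the case that elements of `F^×_mod` or
κ-coric rational functions admit `N`-th roots"; "Kummer black-out": no way to recover the additive
structure on the birational monoid portion of `†ℱ^⊛_mod` without `†ℱ^⊛_mod ↪ †ℱ^⊛`).
([IUTchI] Rmk 5.1.3 p.132) [claim: Mochizuki2012, status: disputed] -/
def kummerStatus : Ex51Object → KummerStatus
  | .Fmod => .blind
  | .Mmod => .blind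
  | .Mκ => .blind
  | _ => .ready

/-! The bracketed reason in Remark 5.1.3 ("it is not necessarily the case that elements of `F^×_mod`
… admit `N`-th roots"), in its simplest instance `F_mod = ℚ`, `N = 2`: `¬ IsSquare (2 : ℚ)` is
ALREADY PROVED in the tree (`Literature.Barriers.BirchSwinnertonDyer.curve480a1.not_isSquare_two`);
not restated here (gate dedup). -/

/-- **Remark 5.1.5**, final display (pp. 133–134), for an extension `1 → Δ → Π → G → 1` (the tree's
`FundamentalExtension`) and the kernel `G^{[sol]} ⊆ G` of the maximal [pro-]solvable quotient: "the
outer action [of `G` on `Δ`] does not admit a solvable factorization", i.e. it is NOT the case that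
every element of `Π` lying over `G^{[sol]}` acts on `Δ` by an inner automorphism of `Δ` [a formal
consequence of the Galois injectivity of [NodNon] Thm C].  A predicate, not asserted.
([IUTchI] Rmk 5.1.5 p.133) [claim: Mochizuki2012, status: disputed] -/
@[mk_iff] structure NoSolvableFactorization (E : FundamentalExtension.{u}) (solKer : Subgroup E.gal) : Prop where
  not_inner : ¬ ∀ g : E.arith, E.aug g ∈ solKer → ∃ d ∈ E.geom, ∀ x ∈ E.geom, g * x * g⁻¹ = d * x * d⁻¹

end Literature.IUT.HodgeTheaters
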